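import Mathlib
import Summits.Ventures.PercRepro2.SwOutMultiRootEThm
import Summits.Ventures.PercRepro2.SwOutMultiRootExempt

/-!
# THE EXEMPTION INDUCTION WITH ROOT–ROOT EDGES (blind cell PercRepro2, night-4 g34, 2026-08-29;
proofs/NIGHT4-G34.md §8)

`rigidOK_g_of_junctions_star` (SwOutMultiRootExempt) with the junctions allowed to be joined to `h`
and to each other by edges (`rigidOK_g_of_multiRootE` on every escaping-vector part):
**`rigidOK_g_of_junctions_starE`**.  The original docstring follows.

A junction `u` of a class is ESCAPING at a side point when its hull leaves the region.  Under the
hypothesis (★) — every escaping junction lies in the red cluster of `l` (at the graph level, where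
the only outside vertex is `l`: a junction that cannot escape in blue, e.g. a blue neighbour of the
mark of the mark step, whose pattern forbids `u ∈ C_B(l)`) — the side of a class with the
junctions `J` is the disjoint union, over the subsets `T ⊆ J`, of the NON-ESCAPING PARTS of the
sides with the junctions of `T` EXEMPT (forced into `C_R(l)` by `𝓤 ∩ {S ∣ T ⊆ S}`) and the
junctions of `J ∖ T` as roots: the multi-root core cube theorem `rigidOK_g_of_multiRoot` on each
part gives the rigid counting inequality on the whole side — **`rigidOK_g_of_junctions_star`** —
with NO hypothesis on the neighbourhoods of the junctions (adjacent junctions after g29's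
subdivision of the edge, mixed junctions, any number of them).

Census (mining/night-4/g34/mrcube.py): the decomposition is verified with Hall on every cube of
every part on the 364 of 387 uncovered mark-step classes at `n = 6` whose junctions satisfy (★)
(3,127 cubes, 4,621 points, 0 failures); the 23 classes with a blue-escaping junction are the
successor's.
-/

namespace Summit.Ventures.PercRepro2

namespace LocRows

open Hull

variable {V : Type*} {E : Type*} [Fintype E] [DecidableEq E]

open scoped Classical

variable {ends : E → Sym2 V} {U : Set V} {ξ : Config E} {l h : V}
  {𝓤 𝓓 𝓓'' : Set (Set V)} {X : Set V} {𝓤' : Set (Set V)} {F : V → Prop}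

section ExemptE

variable {J : Finset V}

variable (h𝓤 : IsUpperSet 𝓤) (h𝓓 : IsLowerSet 𝓓) (h𝓓'' : IsLowerSet 𝓓'') (h𝓤' : IsUpperSet 𝓤')
  (hl : l ∉ U)
  (hloop : ∀ e r, r ∈ insert h (↑J : Set V) → ends e ≠ s(r, r))
  (hF : ∀ x, F x → ∀ S ∈ 𝓤, x ∈ S)
  (hout : ∀ x ∈ U, x ≠ h → x ∉ J →
    F x ∨ x ∈ X ∨ (∃ e y, ends e = s(x, y) ∧ y ∉ U) ∨ (∀ e, x ∉ ends e))
  (hX : ∀ x ∈ X, x ∈ U → ∀ e, x ∈ ends e → ends e = s(x, x))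
  (hhX : h ∉ X) (hJX : ∀ u ∈ J, u ∉ X)
  (hstar : ∀ ζ ∈ gOutSide ends l h 𝓤 𝓓 𝓓'' X 𝓤' U ξ, ∀ u ∈ J,
    ¬ hull ends ζ u ⊆ U → u ∈ cluster ends ζ l)

include h𝓤 h𝓓 h𝓓'' h𝓤' hl hloop hF hout hX hhX hJX hstar in
/-- **THE MULTI-JUNCTION CLASS UNDER (★), EDGES BETWEEN THE JUNCTIONS AND `h` ALLOWED**: the rigid
counting inequality on the general doubly typed side of every class of a region with the junctions
`J` (no loop at `h` or at a junction, every other vertex of `U` exempt, in `X`, with an outside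
edge, or isolated; `X` avoids `{h} ∪ J`), provided every escaping junction lies in the red cluster
of `l` (★). -/
theorem rigidOK_g_of_junctions_starE {𝓔 : Set (Set E)} (h𝓔 : IsUpperSet 𝓔) :
    ((gOutSide ends l h 𝓤 𝓓 𝓓'' X 𝓤' U ξ).filter fun ζ => redEdges ends ζ h ∈ 𝓔).card ≤
      ((gOutSide ends l h 𝓤 𝓓 𝓓'' X 𝓤' U ξ).filter fun ζ => blueEdges ends ζ h ∈ 𝓔).card := by
  set C := gOutSide ends l h 𝓤 𝓓 𝓓'' X 𝓤' U ξ with hC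
  have hmap : ∀ (P' : Config E → Prop) [DecidablePred P'], ∀ ζ ∈ C.filter P',
      escSet ends J l ζ ∈ J.powerset :=
    fun _ _ _ _ => Finset.mem_powerset.2 (Finset.filter_subset _ _)
  rw [Finset.card_eq_sum_card_fiberwise (hmap (fun ζ => redEdges ends ζ h ∈ 𝓔)),
    Finset.card_eq_sum_card_fiberwise (hmap (fun ζ => blueEdges ends ζ h ∈ 𝓔))]
  refine Finset.sum_le_sum fun T hT => ?_
  have hTJ : T ⊆ J := Finset.mem_powerset.1 hT
  have hfib : ∀ (P' : Config E → Prop) [DecidablePred P'],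
      (C.filter P').filter (fun ζ => escSet ends J l ζ = T) =
        (gOutSide ends l h (𝓤 ∩ {S | ∀ u ∈ T, u ∈ S}) 𝓓 𝓓'' X 𝓤' U ξ).filter
          (fun ζ => (∀ r ∈ insert h (↑(J \ T) : Set V), hull ends ζ r ⊆ U) ∧ P' ζ) := by
    intro P' _
    ext ζ
    simp only [Finset.mem_filter]
    constructor
    · rintro ⟨⟨hζ, hP⟩, hesc⟩
      obtain ⟨h1, h2⟩ := (mem_fibre_iff hl hstar hTJ).1 ⟨hζ, hesc⟩
      exact ⟨h1, h2, hP⟩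
    · rintro ⟨h1, h2, hP⟩
      obtain ⟨hζ, hesc⟩ := (mem_fibre_iff hl hstar hTJ).2 ⟨h1, h2⟩
      exact ⟨⟨hζ, hP⟩, hesc⟩
  rw [hfib (fun ζ => redEdges ends ζ h ∈ 𝓔), hfib (fun ζ => blueEdges ends ζ h ∈ 𝓔)]
  -- the multi-root core cube theorem with the roots `h` and `J ∖ T`, the junctions of `T` exempt
  have hsub : insert h (↑(J \ T) : Set V) ⊆ insert h (↑J : Set V) := by
    rintro r (rfl | hr)
    · exact Or.inl rfl
    · rw [Finset.mem_coe, Finset.mem_sdiff] at hr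
      exact Or.inr (Finset.mem_coe.2 hr.1)
  refine rigidOK_g_of_multiRootE (R := insert h (↑(J \ T) : Set V)) (F := fun x => F x ∨ x ∈ T)
    (isUpperSet_exempt h𝓤 T) h𝓓 h𝓓'' h𝓤' hl (Or.inl rfl) ?_ ?_ ?_ hX ?_ h𝓔
  · intro e r hr
    exact hloop e r (hsub hr)
  · rintro x (hx | hx) S ⟨hS, hTS⟩
    · exact hF x hx S hS
    · exact hTS x hx
  · intro x hxU hxR
    have hxh : x ≠ h := fun h' => hxR (h' ▸ Or.inl rfl)
    by_cases hxJ : x ∈ J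
    · have hxT : x ∈ T := by
        by_contra hxT
        exact hxR (Or.inr (by rw [Finset.mem_coe, Finset.mem_sdiff]; exact ⟨hxJ, hxT⟩))
      exact Or.inl (Or.inr hxT)
    · rcases hout x hxU hxh hxJ with hf | hxX | hout' | hiso
      · exact Or.inl (Or.inl hf)
      · exact Or.inr (Or.inl hxX)
      · exact Or.inr (Or.inr (Or.inl hout'))
      · exact Or.inr (Or.inr (Or.inr hiso))
  · rintro r (rfl | hr)
    · exact hhX
    · rw [Finset.mem_coe, Finset.mem_sdiff] at hr
      exact hJX r hr.1

end ExemptE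

end LocRows

end Summit.Ventures.PercRepro2
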